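import Literature.MathematicalPhysics.QuantumLattice.SublatticeSelectiveInteractions
import HarnessLib

/-!
# Coupled two-leg ladder arrays on `ℤ²` as a superlattice family: the complete-coset decomposition of a
# hopping, the layer (period-2) cosets, and the CONCAVITY SANDWICH
# `e(t, t_⊥, s) ≥ (1 − s/t_⊥)·e(decoupled ladders) + (s/t_⊥)·e(square lattice)`

Topic `Literature/MathematicalPhysics/QuantumLattice` (family `hubbard`; §1–§3 general dimension `d`, §4 `ℤ²`).
Sequel of `SublatticeSelectiveInteractions` (`InCoset`, `sublatticeVectorHopping` and its views, `layerPeriods`) and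
`SuperlatticeCellEnergyFamilies` (`cellEnergy`, `viewFamily`, `infCellEnergyOn`, its concavity / Lipschitz calculus,
«periodic order cannot lower a translation-invariant model»). Written for stage S2 (CERTIFIER-FAMILIES, «families
of models») of the Hubbard material-oracle programme and the router's LADDER boxes (two-leg cuprate ladders with
inter-ladder couplings, e.g. box #32 `Sr₁₄₋ₓCaₓCu₂₄O₄₁`: «S2 has no ladder instrument»): the ladder array is a
superlattice one-band model on `ℤ²` — legs along `e₁` everywhere, rungs = `e₂`-bonds from even rows, inter-ladder
bonds = `e₂`-bonds from odd rows — so the superlattice calculus applies, and joint concavity in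
`(t_leg, t_rung, t_inter)` sandwiches every coupled-ladder array between the DECOUPLED ladders (`t_inter = 0`)
and the anisotropic SQUARE LATTICE (`t_inter = t_rung`).

* §1 the cell representative `cellRep q x` of a site (coordinatewise remainder), `x ∈ coset(pos(cellRep x))` and
  in no other coset of the cell (`inCoset_cellPos_iff`); **COMPLETE-COSET DECOMPOSITION**
  `Σ_{n∈C} Φ_{q, pos n, v} = Φ_v` (and with all labels re-centred): the sublattice-selective hoppings over the
  fundamental cell reassemble the full hopping along `v`.
* §2 class constant for constant views from a uniform single-state bound (`abs_cellEnergy_const_le`).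
* §3 two-layer superlattices `layerPeriods i₀`: coset membership is a parity (`inCoset_layerPeriods_iff`), the two
  cosets `c`, `c + e_{i₀}` are complementary, and `Φ_{q,c,v} + Φ_{q,c+e_{i₀},v} = Φ_v`.
* §4 (`ℤ²`) **`ladderArrayViews U (t_leg, t_rung, t_inter)`** (a `viewFamily` over `layerPeriods 1`);
  `anisotropicHubbard U t_x t_y = Φ^{0,U} + t_xΦ_{e₁} + t_yΦ_{e₂}`; by instantiation: joint concavity in the three
  hoppings over every class, Lipschitz `Σ_a 2|Δθ_a|` (`R ≥ 1`); **at `t_inter = t_rung` every view IS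
  `anisotropicHubbard U t t_⊥`** (complete-coset decomposition), hence over the periodic states the variational
  cell energy is `tiGroundEnergyDensity (anisotropicHubbard U t t_⊥)`; and **THE SANDWICH**: for `0 ≤ s ≤ t_⊥`
  and every class, `(1 − s/t_⊥)·e_S(t,t_⊥,0) + (s/t_⊥)·e_S(t,t_⊥,t_⊥) ≤ e_S(t,t_⊥,s)`
  (`infCellEnergyOn_ladderArray_ge_chord`; periodic-class form with the square-lattice density on the right of
  the chord, `…_ge_chord_periodic`) — certified floors for decoupled ladders (quasi-one-dimensional objects) and
  for the square lattice floor every intermediate inter-ladder coupling at zero cost.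

Everything is PROVED; definitions with bodies (`cellRep`, `ladderArrayViews`, `anisotropicHubbard`), no named
fact, no number of record, no `sorry`. HONEST SCOPE: energy words only; norm class constants; one-sided (the
sandwich is a FLOOR; caps come from trial states / tangent planes of the calculus); the diagonal inter-ladder
hoppings of a real trellis lattice are further `sublatticeVectorHopping` directions (not instantiated here);
nothing certifies a number about a material.

## Mathlib / tree search

REUSED: `InCoset`, `inCoset_sub_iff`, `sublatticeVectorHopping(_apply_pair/_apply_eq_zero)`, `sublatticeVectorHoppingViews`,
`abs_cellEnergy_sublatticeVectorHoppingViews_le`, `layerPeriods` (`SublatticeSelectiveInteractions`); `Cell`, `cellPos`, `periodVec`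
(`PeriodicStatesCellAverage`); `InfVolFermionState.cellEnergy`, `viewFamily`, `infCellEnergyOn`, `periodicStates`,
`concaveOn_infCellEnergyOn_viewFamily`, `abs_infCellEnergyOn_viewFamily_sub_le`, `infCellEnergyOn_periodic_const_eq_tiGroundEnergyDensity`
(`SuperlatticeCellEnergyFamilies`); `vectorHoppingFermionInteraction(_apply_eq_zero)`, `abs_meanEnergy_vectorHopping_le`,
`FermionInteraction.linearFamily(_apply)`, `unitVec_mem_thicken_one`, `thicken_mono`, `uvec_ne_zero`; Mathlib `Int.emod_nonneg`,
`Int.emod_lt_of_pos`, `Int.emod_emod_of_dvd`, `Int.emod_eq_emod_iff_emod_sub_eq_zero`, `Int.emod_eq_of_lt`, `Finset.sum_ite_eq'`.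
`lean search 'ladder.*Views|cellRep|trellis|anisotropicHubbard' --decl` (QuantumLattice): nothing of this kind
(the tree's `HubbardLadder` summit files are finite-cluster objects, unrelated).

## References

* R. B. Israel, *Convexity in the Theory of Lattice Gases* (1979), Thm. I.3.4. [cite: Israel1979, Thm. I.3.4]
* O. Bratteli, A. Kishimoto, D. W. Robinson, CMP 64 (1978) 41, §3, Thm. 2. [cite: BratteliKishimotoRobinson1978, Thm. 2 (condition 2)]
* O. Bratteli, D. W. Robinson, *OAQSM 1* (1987), Prop. 2.3.11. [cite: BratteliRobinsonI1987, Prop. 2.3.11]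
* H. Araki, H. Moriya, Rev. Math. Phys. 15 (2003) 93, §4.1. [cite: ArakiMoriya2003, §4.1]
* E. Pavarini et al., PRL 87 (2001) 047003, eq. (1). [cite: PavariniEtAl2001, eq. (1)]
-/

noncomputable section

namespace Literature.MathematicalPhysics.QuantumLattice

open Matrix Finset HubbardWave0 Literature.Probability.LatticeModels ThermodynamicLimit
open Literature.Computation.Certificates
open scoped ComplexOrder BigOperators

/-! ### §1. The cell representative of a site and the complete-coset decomposition of a hopping term -/

section CellRep

variable {d : ℕ}

/-- The period `q_i + 1` as a positive integer. [cite: ArakiMoriya2003, §4.1] -/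
theorem periodInt_pos (q : Fin d → ℕ) (i : Fin d) : (0 : ℤ) < (q i : ℤ) + 1 := by positivity

/-- **The cell representative of a site**: `(x_i mod (q_i+1))_i ∈ Π_i Fin (q_i+1)`. [cite: ArakiMoriya2003, §4.1] -/
def cellRep (q : Fin d → ℕ) (x : Site d) : Cell q := fun i =>
  ⟨(x i % ((q i : ℤ) + 1)).toNat, by
    have h0 : 0 ≤ x i % ((q i : ℤ) + 1) := Int.emod_nonneg _ (periodInt_pos q i).ne'
    have h1 : x i % ((q i : ℤ) + 1) < (q i : ℤ) + 1 := Int.emod_lt_of_pos _ (periodInt_pos q i)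
    omega⟩

/-- The position of the cell representative is the coordinatewise remainder. [cite: ArakiMoriya2003, §4.1] -/
theorem cellPos_cellRep (q : Fin d → ℕ) (x : Site d) (i : Fin d) :
    cellPos (cellRep q x) i = x i % ((q i : ℤ) + 1) := by
  simp only [cellPos, cellRep]
  exact Int.toNat_of_nonneg (Int.emod_nonneg _ (periodInt_pos q i).ne')

/-- **Every site lies in the coset of its cell representative.** [cite: ArakiMoriya2003, §4.1] -/
theorem inCoset_cellPos_cellRep (q : Fin d → ℕ) (x : Site d) : InCoset q (cellPos (cellRep q x)) x := by
  intro i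
  rw [cellPos_cellRep, Int.sub_emod, Int.emod_emod_of_dvd _ (dvd_refl _), sub_self, Int.zero_emod]

/-- **… and in no other coset of the fundamental cell**: `x ∈ coset(pos n) ↔ n = cellRep x`.
[cite: ArakiMoriya2003, §4.1] -/
theorem inCoset_cellPos_iff (q : Fin d → ℕ) (n : Cell q) (x : Site d) : InCoset q (cellPos n) x ↔ n = cellRep q x := by
  constructor
  · intro h
    funext i
    apply Fin.ext
    have hi := h i
    have hn0 : (0 : ℤ) ≤ ((n i : ℕ) : ℤ) := Nat.cast_nonneg _
    have hn1 : ((n i : ℕ) : ℤ) < (q i : ℤ) + 1 := by exact_mod_cast (n i).isLt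
    have hx : x i % ((q i : ℤ) + 1) = ((n i : ℕ) : ℤ) := by
      rw [cellPos] at hi
      rw [← Int.emod_eq_of_lt hn0 hn1]
      exact (Int.emod_eq_emod_iff_emod_sub_eq_zero.2 hi)
    have := cellPos_cellRep q x i
    rw [hx, cellPos] at this
    exact_mod_cast this.symm
  · rintro rfl
    exact inCoset_cellPos_cellRep q x

/-- **COMPLETE-COSET DECOMPOSITION**: summed over the coset labels of the fundamental cell, the
sublattice-selective hoppings along `v` reassemble the full hopping along `v`:
`Σ_{n ∈ C} Φ_{q, pos n, v} X = Φ_v X` (every bond starts in exactly one coset). [cite: PavariniEtAl2001, eq. (1)] -/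
theorem sum_sublatticeVectorHopping_cellPos_apply (q : Fin d → ℕ) {v : Site d} (hv : v ≠ 0) (t : ℝ) (X : Finset (Site d)) :
    ∑ n : Cell q, (sublatticeVectorHopping q (cellPos n) v t).Φ X = (vectorHoppingFermionInteraction d v t).Φ X := by
  by_cases hX : ∃ x : Site d, X = {x, x + v}
  · obtain ⟨x, rfl⟩ := hX
    simp only [sublatticeVectorHopping_apply_pair q _ hv t x, inCoset_cellPos_iff]
    rw [Finset.sum_ite_eq' Finset.univ (cellRep q x), if_pos (Finset.mem_univ _)]
  · push Not at hX
    rw [vectorHoppingFermionInteraction_apply_eq_zero t hX]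
    exact Finset.sum_eq_zero fun n _ => sublatticeVectorHopping_apply_eq_zero q _ v t hX

/-- The same with all labels re-centred by `−w` (the cosets `pos n − w` still form a complete system).
[cite: PavariniEtAl2001, eq. (1)] -/
theorem sum_sublatticeVectorHopping_cellPos_sub_apply (q : Fin d → ℕ) {v : Site d} (hv : v ≠ 0) (t : ℝ) (w : Site d)
    (X : Finset (Site d)) :
    ∑ n : Cell q, (sublatticeVectorHopping q (cellPos n - w) v t).Φ X = (vectorHoppingFermionInteraction d v t).Φ X := by
  by_cases hX : ∃ x : Site d, X = {x, x + v}
  · obtain ⟨x, rfl⟩ := hX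
    simp only [sublatticeVectorHopping_apply_pair q _ hv t x, inCoset_sub_iff, inCoset_cellPos_iff]
    rw [Finset.sum_ite_eq' Finset.univ (cellRep q (x + w)), if_pos (Finset.mem_univ _)]
  · push Not at hX
    rw [vectorHoppingFermionInteraction_apply_eq_zero t hX]
    exact Finset.sum_eq_zero fun n _ => sublatticeVectorHopping_apply_eq_zero q _ v t hX

end CellRep

/-! ### §2. Constant views: class constant from a single-state bound -/

section ConstViews

variable {d : ℕ} {q : Fin d → ℕ}

/-- A uniform bound on `|e_Ψ|` over all states bounds the cell energy of the constant views `(Ψ)`.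
[cite: BratteliRobinsonI1987, Prop. 2.3.11] -/
theorem abs_cellEnergy_const_le (Ψ : FermionInteraction d) (R : ℝ) {B : ℝ}
    (hB : ∀ σ : InfVolFermionState d, |σ.meanEnergy Ψ R| ≤ B) (ω : InfVolFermionState d) :
    |ω.cellEnergy (fun _ : Cell q => Ψ) R| ≤ B := by
  have hcard : (0 : ℝ) < (Fintype.card (Cell q) : ℝ) := Nat.cast_pos.2 Fintype.card_pos
  rw [InfVolFermionState.cellEnergy, abs_mul, abs_of_pos (inv_pos.2 hcard)]
  calc (Fintype.card (Cell q) : ℝ)⁻¹ * |∑ n : Cell q, (ω.shift (cellPos n)).meanEnergy Ψ R|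
      ≤ (Fintype.card (Cell q) : ℝ)⁻¹ * ∑ _n : Cell q, B :=
        mul_le_mul_of_nonneg_left ((Finset.abs_sum_le_sum_abs _ _).trans (Finset.sum_le_sum fun n _ => hB _))
          (inv_pos.2 hcard).le
    _ = B := by rw [Finset.sum_const, Finset.card_univ, nsmul_eq_mul, ← mul_assoc, inv_mul_cancel₀ hcard.ne', one_mul]

end ConstViews

/-! ### §3. Two-layer superlattices: the two cosets of `layerPeriods i₀` reassemble every hopping -/

section Layers

variable {d : ℕ}

/-- Membership in a coset of the two-layer superlattice (period `2` along `e_{i₀}`, `1` elsewhere) is the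
parity of the `i₀`-th coordinate difference. [cite: ArakiMoriya2003, §4.1] -/
theorem inCoset_layerPeriods_iff (i₀ : Fin d) (c x : Site d) :
    InCoset (layerPeriods i₀) c x ↔ (x i₀ - c i₀) % 2 = 0 := by
  have h2 : ((layerPeriods i₀ i₀ : ℕ) : ℤ) + 1 = 2 := by
    simp only [layerPeriods, if_true, Nat.cast_one]; norm_num
  have h1 : ∀ i, i ≠ i₀ → ((layerPeriods i₀ i : ℕ) : ℤ) + 1 = 1 := fun i hi => by
    simp only [layerPeriods, if_neg hi, Nat.cast_zero, zero_add]
  constructor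
  · intro h
    have h0 := h i₀
    rwa [h2] at h0
  · intro h i
    by_cases hi : i = i₀
    · subst hi
      rwa [h2]
    · rw [h1 i hi, Int.emod_one]

/-- **The two layer cosets are complementary**: `x ∈ coset(c)` xor `x ∈ coset(c + e_{i₀})`.
[cite: ArakiMoriya2003, §4.1] -/
theorem inCoset_layerPeriods_add_unitVec_iff (i₀ : Fin d) (c x : Site d) :
    InCoset (layerPeriods i₀) (c + unitVec i₀) x ↔ ¬ InCoset (layerPeriods i₀) c x := by
  rw [inCoset_layerPeriods_iff, inCoset_layerPeriods_iff, Pi.add_apply, unitVec, Pi.single_eq_same]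
  omega

/-- **The two layer-selective hoppings reassemble the full hopping**:
`Φ_{q,c,v} X + Φ_{q,c+e_{i₀},v} X = Φ_v X` for the two-layer superlattice `q = layerPeriods i₀`.
[cite: PavariniEtAl2001, eq. (1)] -/
theorem sublatticeVectorHopping_layer_add_apply (i₀ : Fin d) (c : Site d) {v : Site d} (hv : v ≠ 0) (t : ℝ)
    (X : Finset (Site d)) :
    (sublatticeVectorHopping (layerPeriods i₀) c v t).Φ X + (sublatticeVectorHopping (layerPeriods i₀) (c + unitVec i₀) v t).Φ X =
      (vectorHoppingFermionInteraction d v t).Φ X := by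
  by_cases hX : ∃ x : Site d, X = {x, x + v}
  · obtain ⟨x, rfl⟩ := hX
    rw [sublatticeVectorHopping_apply_pair _ _ hv, sublatticeVectorHopping_apply_pair _ _ hv]
    by_cases hc : InCoset (layerPeriods i₀) c x
    · have hc' : ¬ InCoset (layerPeriods i₀) (c + unitVec i₀) x :=
        fun h' => (inCoset_layerPeriods_add_unitVec_iff i₀ c x).1 h' hc
      rw [if_pos hc, if_neg hc', add_zero]
    · have hc' : InCoset (layerPeriods i₀) (c + unitVec i₀) x := (inCoset_layerPeriods_add_unitVec_iff i₀ c x).2 hc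
      rw [if_neg hc, if_pos hc', zero_add]
  · push Not at hX
    rw [vectorHoppingFermionInteraction_apply_eq_zero t hX, sublatticeVectorHopping_apply_eq_zero _ _ v t hX,
      sublatticeVectorHopping_apply_eq_zero _ _ v t hX, add_zero]

end Layers

/-! ### §4. The two-leg LADDER ARRAY (trellis-type coupled ladders) on `ℤ²` -/

section LadderArray

/-- **The coupled two-leg ladder array on `ℤ²` as a superlattice family** over the two-layer superlattice
`layerPeriods 1` (rows of even / odd `x₂`). Couplings `θ = (t_leg, t_rung, t_inter)`: legs = ALL bonds along
`e₁` (translation invariant, constant views), rungs = the bonds along `e₂` starting on EVEN rows (coset of `0`),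
inter-ladder bonds = the bonds along `e₂` starting on ODD rows (coset of `e₂`); on-site repulsion `U`
everywhere (constant views `Φ^{0,U}`). At `t_inter = 0` the ladders decouple; at `t_inter = t_rung` the array is
the (anisotropic) square lattice. The object the router's ladder boxes (two-leg cuprate ladders with
inter-ladder couplings) ask a solver to take, inside the one-band CAR framework over `ℤ²`. [cite: PavariniEtAl2001, eq. (1)] -/
def ladderArrayViews (U : ℝ) (θ : Fin 3 → ℝ) : Cell (layerPeriods (1 : Fin 2)) → FermionInteraction 2 :=
  viewFamily (fun _ => hubbardFermionInteraction 2 0 U)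
    (![fun _ => vectorHoppingFermionInteraction 2 (unitVec 0) 1,
      sublatticeVectorHoppingViews (layerPeriods 1) 0 (unitVec 1) 1,
      sublatticeVectorHoppingViews (layerPeriods 1) (unitVec 1) (unitVec 1) 1]) θ

/-- **Joint concavity of the ladder array's variational cell energy in `(t_leg, t_rung, t_inter)`** over every
state class. [cite: Israel1979, Thm. I.3.4] -/
theorem concaveOn_infCellEnergyOn_ladderArray (S : Set (InfVolFermionState 2)) (U R : ℝ) :
    ConcaveOn ℝ Set.univ fun θ : Fin 3 → ℝ => infCellEnergyOn S (ladderArrayViews U θ) R :=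
  concaveOn_infCellEnergyOn_viewFamily S _ _ R

/-- **Lipschitz continuity in the three hoppings** (any non-empty class, range parameter `R ≥ 1`): every
coupling moves the variational cell energy by at most `2` per unit amplitude. [cite: Israel1979, Thm. I.3.4] -/
theorem abs_infCellEnergyOn_ladderArray_sub_le {S : Set (InfVolFermionState 2)} (hS : S.Nonempty) (U : ℝ) {R : ℝ}
    (hR : 1 ≤ R) (θ θ' : Fin 3 → ℝ) :
    |infCellEnergyOn S (ladderArrayViews U θ) R - infCellEnergyOn S (ladderArrayViews U θ') R| ≤ ∑ a, 2 * |θ a - θ' a| := by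
  have h1R : (unitVec 1 : Site 2) ∈ thicken ({0} : Finset (Site 2)) R := thicken_mono _ hR (unitVec_mem_thicken_one 1)
  have h0R : (unitVec 0 : Site 2) ∈ thicken ({0} : Finset (Site 2)) R := thicken_mono _ hR (unitVec_mem_thicken_one 0)
  refine abs_infCellEnergyOn_viewFamily_sub_le _ _ R hS (fun ω _ a => ?_) θ θ'
  fin_cases a
  · simpa using abs_cellEnergy_const_le (q := layerPeriods (1 : Fin 2)) (vectorHoppingFermionInteraction 2 (unitVec 0) 1) R
      (fun σ => by simpa using abs_meanEnergy_vectorHopping_le (uvec_ne_zero 0) 1 σ h0R) ω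
  · simpa using abs_cellEnergy_sublatticeVectorHoppingViews_le (layerPeriods (1 : Fin 2)) 0 (uvec_ne_zero 1) 1 h1R ω
  · simpa using abs_cellEnergy_sublatticeVectorHoppingViews_le (layerPeriods (1 : Fin 2)) (unitVec 1) (uvec_ne_zero 1) 1 h1R ω

/-- **The anisotropic square-lattice Hubbard interaction** `Φ^{0,U} + t_x Φ_{e₁} + t_y Φ_{e₂}` (as a linear
family of the two unit hops). [cite: PavariniEtAl2001, eq. (1)] -/
def anisotropicHubbard (U tx ty : ℝ) : FermionInteraction 2 :=
  FermionInteraction.linearFamily (hubbardFermionInteraction 2 0 U)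
    (![vectorHoppingFermionInteraction 2 (unitVec 0) 1, vectorHoppingFermionInteraction 2 (unitVec 1) 1]) ![tx, ty]

/-- **At `t_inter = t_rung` every view of the ladder array is the anisotropic square-lattice Hubbard
interaction** `Φ^{0,U} + t Φ_{e₁} + t_⊥ Φ_{e₂}` — the even-row and odd-row `e₂`-bonds reassemble all
`e₂`-bonds. [cite: PavariniEtAl2001, eq. (1)] -/
theorem ladderArrayViews_inter_eq_rung (U t tperp : ℝ) (n : Cell (layerPeriods (1 : Fin 2))) :
    ladderArrayViews U ![t, tperp, tperp] n = anisotropicHubbard U t tperp := by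
  refine FermionInteraction.ext fun X => ?_
  simp only [ladderArrayViews, anisotropicHubbard, viewFamily, FermionInteraction.linearFamily_apply, Fin.sum_univ_three,
    Fin.sum_univ_two, Matrix.cons_val_zero, Matrix.cons_val_one, Matrix.cons_val_two, Matrix.head_cons, Matrix.tail_cons,
    sublatticeVectorHoppingViews]
  have hsum := sublatticeVectorHopping_layer_add_apply (1 : Fin 2) (0 - cellPos n) (v := unitVec 1) (uvec_ne_zero 1) 1 X
  rw [show (0 : Site 2) - cellPos n + unitVec 1 = unitVec 1 - cellPos n by abel] at hsum
  rw [add_assoc, ← smul_add, hsum]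

/-- **CONSISTENCY AT `t_inter = t_rung`**: over the periodic states the ladder array's variational cell energy
is the translation-invariant density of the anisotropic square-lattice Hubbard model.
[cite: BratteliKishimotoRobinson1978, Thm. 2 (condition 2)] -/
theorem infCellEnergyOn_ladderArray_inter_eq_rung (U t tperp R : ℝ) :
    infCellEnergyOn (periodicStates (layerPeriods (1 : Fin 2))) (ladderArrayViews U ![t, tperp, tperp]) R =
      (anisotropicHubbard U t tperp).tiGroundEnergyDensity R := by
  have h : ladderArrayViews U ![t, tperp, tperp] = fun _ => anisotropicHubbard U t tperp :=
    funext fun n => ladderArrayViews_inter_eq_rung U t tperp n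
  rw [h]
  exact infCellEnergyOn_periodic_const_eq_tiGroundEnergyDensity _ _ R

/-- **THE CONCAVITY SANDWICH FOR COUPLED LADDERS**: for `0 ≤ s ≤ t_⊥` and every state class, the variational
cell energy of the ladder array at inter-ladder hopping `s` is AT LEAST the chord between the DECOUPLED ladders
(`t_inter = 0`) and the SQUARE LATTICE (`t_inter = t_⊥`):
`e(t, t_⊥, s) ≥ (1 − s/t_⊥)·e(t, t_⊥, 0) + (s/t_⊥)·e(t, t_⊥, t_⊥)` — certified floors for decoupled ladders
(quasi-one-dimensional objects) and for the square lattice give a floor for every intermediate inter-ladder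
coupling, at zero cost. [cite: Israel1979, Thm. I.3.4] -/
theorem infCellEnergyOn_ladderArray_ge_chord (S : Set (InfVolFermionState 2)) (U R t : ℝ) {tperp s : ℝ}
    (htp : 0 < tperp) (hs0 : 0 ≤ s) (hs1 : s ≤ tperp) :
    (1 - s / tperp) * infCellEnergyOn S (ladderArrayViews U ![t, tperp, 0]) R +
        s / tperp * infCellEnergyOn S (ladderArrayViews U ![t, tperp, tperp]) R ≤
      infCellEnergyOn S (ladderArrayViews U ![t, tperp, s]) R := by
  have hc := concaveOn_infCellEnergyOn_ladderArray S U R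
  have ha : 0 ≤ 1 - s / tperp := sub_nonneg.2 ((div_le_one htp).2 hs1)
  have hb : 0 ≤ s / tperp := div_nonneg hs0 htp.le
  have h := hc.2 (Set.mem_univ ![t, tperp, 0]) (Set.mem_univ ![t, tperp, tperp]) ha hb (by ring)
  have hmid : (1 - s / tperp) • (![t, tperp, 0] : Fin 3 → ℝ) + (s / tperp) • (![t, tperp, tperp] : Fin 3 → ℝ) = ![t, tperp, s] := by
    funext a
    fin_cases a <;> simp <;> field_simp <;> ring
  rw [hmid] at h
  simpa only [smul_eq_mul] using h

/-- **Sandwich with the certified square lattice** (periodic states, `0 ≤ s ≤ t_⊥`): the coupled-ladder cell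
energy is at least the chord between the decoupled-ladder value and the translation-invariant density of the
anisotropic square-lattice model. [cite: Israel1979, Thm. I.3.4] -/
theorem infCellEnergyOn_ladderArray_ge_chord_periodic (U R t : ℝ) {tperp s : ℝ} (htp : 0 < tperp) (hs0 : 0 ≤ s)
    (hs1 : s ≤ tperp) :
    (1 - s / tperp) * infCellEnergyOn (periodicStates (layerPeriods (1 : Fin 2))) (ladderArrayViews U ![t, tperp, 0]) R +
        s / tperp * (anisotropicHubbard U t tperp).tiGroundEnergyDensity R ≤
      infCellEnergyOn (periodicStates (layerPeriods (1 : Fin 2))) (ladderArrayViews U ![t, tperp, s]) R := by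
  rw [← infCellEnergyOn_ladderArray_inter_eq_rung U t tperp R]
  exact infCellEnergyOn_ladderArray_ge_chord _ U R t htp hs0 hs1

end LadderArray

end Literature.MathematicalPhysics.QuantumLattice

end
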